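import Summits.Parity.GeneralizedHardyLittlewood.Theorems.FordMaynardNoSieveConst0164NegWitness0164Majorants

/-!
# Route `FordMaynardNoSieveConst0164`, crux `NegWitness0164` (stmt-Parity-19102), line `birth`,
# stub `stub_tweakNeg0164`: enclosure layer — cell faces are null for three-dimensional slice integrals

Helper file toward the certificate stub (K. Ford, J. Maynard, *On the theory of prime producing sieves*,
arXiv:2407.14368, §8).  The cells of the table in (II') are half-open boxes `[e, e + w)`; the translation lemma
`sliceIntegral_translate` (`…SliceShift`) that moves a cell to the symmetric unit box wants integrands supported in the
OPEN orthant `{v > e}`.  For UPPER bounds (the α-families) one cannot simply shrink the cell, so we record that the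
faces do not matter: two integrands that agree off the three coordinate hyperplanes `{v_k = e_k}` have the same slice
integral over `Δ₃(α)` (the exceptional parameter set is contained in two lines and one anti-diagonal of `ℝ²`).

* `volume_coord_eq_zero_fin_two`, `volume_add_eq_zero_fin_two` — the null sets;
* `sliceIntegral_three_congr_off_faces` — **`∫_{Δ₃(α)} G = ∫_{Δ₃(α)} G'` whenever `G = G'` off `⋃_k {v_k = e_k}`**;
* `sliceIntegral_three_closedCell_eq_openCell` — the half-open and the open cell give the same integral.

Def-free.  References: [FordMaynard2024PrimeSieves] arXiv:2407.14368, §8 (proof of Theorem 2.7 (c)); folklore measure theory.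
-/

noncomputable section

open Finset MeasureTheory Set
open scoped Classical
open Literature.NumberTheory.Sieve Literature.NumberTheory.Sieve.FordMaynard

namespace Summit.Parity.GeneralizedHardyLittlewood.FordMaynardNoSieveConst0164NegWitness0164

/-- A coordinate hyperplane `{u | u_k = c}` of `ℝ²` is a null set. [folklore] -/
theorem volume_coord_eq_zero_fin_two (k : Fin 2) (c : ℝ) : volume {u : Fin 2 → ℝ | u k = c} = 0 := by
  have h : {u : Fin 2 → ℝ | u k = c} ⊆
      Set.pi Set.univ (fun i => if i = k then ({c} : Set ℝ) else Set.univ) := by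
    intro u hu i _
    by_cases hi : i = k
    · subst hi
      simpa using hu
    · simp [hi]
  refine measure_mono_null h ?_
  rw [volume_pi_pi]
  exact Finset.prod_eq_zero (Finset.mem_univ k) (by simp)

/-- An anti-diagonal `{u | u₀ + u₁ = c}` of `ℝ²` is a null set. [folklore] -/
theorem volume_add_eq_zero_fin_two (c : ℝ) : volume {u : Fin 2 → ℝ | u 0 + u 1 = c} = 0 := by
  have hm : MeasurableSet {p : ℝ × ℝ | p.1 + p.2 = c} :=
    measurableSet_eq_fun (measurable_fst.add measurable_snd) measurable_const
  have h1 : volume {p : ℝ × ℝ | p.1 + p.2 = c} = 0 := by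
    rw [Measure.volume_eq_prod, Measure.prod_apply hm]
    have hsec : ∀ x : ℝ, volume (Prod.mk x ⁻¹' {p : ℝ × ℝ | p.1 + p.2 = c}) = 0 := by
      intro x
      have : Prod.mk x ⁻¹' {p : ℝ × ℝ | p.1 + p.2 = c} = {c - x} := by
        ext y
        simp only [Set.mem_preimage, Set.mem_setOf_eq, Set.mem_singleton_iff]
        constructor
        · intro h; linarith
        · intro h; linarith
      rw [this, Real.volume_singleton]
    simp only [hsec, lintegral_zero]
  have hpre : {u : Fin 2 → ℝ | u 0 + u 1 = c} = MeasurableEquiv.finTwoArrow ⁻¹' {p : ℝ × ℝ | p.1 + p.2 = c} := by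
    ext u
    simp [MeasurableEquiv.finTwoArrow_apply]
  rw [hpre, (volume_preserving_finTwoArrow ℝ).measure_preimage hm.nullMeasurableSet, h1]

/-- **Cell faces are null for `∫_{Δ₃(α)}`**: if `G = G'` at every `v` with `v_k ≠ e_k` for all `k`, the two slice
integrals over `Δ₃(α)` agree. [folklore] -/
theorem sliceIntegral_three_congr_off_faces (α : ℝ) (e : Fin 3 → ℝ) {G G' : (Fin 3 → ℝ) → ℝ}
    (h : ∀ v : Fin 3 → ℝ, (∀ k, v k ≠ e k) → G v = G' v) :
    sliceIntegral 3 α G = sliceIntegral 3 α G' := by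
  rw [sliceIntegral_succ_eq, sliceIntegral_succ_eq]
  refine integral_congr_ae ?_
  have hnull : volume (({u : Fin 2 → ℝ | u 0 = e 0} ∪ {u : Fin 2 → ℝ | u 1 = e 1}) ∪
      {u : Fin 2 → ℝ | u 0 + u 1 = α - e 2}) = 0 :=
    measure_union_null (measure_union_null (volume_coord_eq_zero_fin_two 0 _)
      (volume_coord_eq_zero_fin_two 1 _)) (volume_add_eq_zero_fin_two _)
  refine (measure_mono_null (fun u hu => ?_) hnull : volume {u : Fin 2 → ℝ | ¬ _} = 0)
  by_contra hmem
  simp only [Set.mem_union, Set.mem_setOf_eq, not_or] at hmem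
  apply hu
  change sliceIntegrand 2 α G u = sliceIntegrand 2 α G' u
  unfold sliceIntegrand
  by_cases hc : (∀ i : Fin 2, 0 < u i) ∧ ∑ i, u i < α
  · rw [if_pos hc, if_pos hc]
    apply h
    intro k
    rw [snoc_fin_two_eq]
    fin_cases k
    · simpa using hmem.1.1
    · simpa using hmem.1.2
    · simp only [Fin.sum_univ_two]
      show α - (u 0 + u 1) ≠ e 2
      intro h'
      exact hmem.2 (by linarith)
  · rw [if_neg hc, if_neg hc]

/-- **The half-open and the open cell give the same slice integral.** [folklore] -/
theorem sliceIntegral_three_closedCell_eq_openCell (α : ℝ) (e : Fin 3 → ℝ) (F : (Fin 3 → ℝ) → ℝ) :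
    sliceIntegral 3 α (fun v => if ∀ k, e k ≤ v k ∧ v k < e k + 7 / 500 then F v else 0) =
      sliceIntegral 3 α (fun v => if ∀ k, e k < v k ∧ v k < e k + 7 / 500 then F v else 0) := by
  refine sliceIntegral_three_congr_off_faces α e fun v hv => ?_
  have hiff : (∀ k, e k ≤ v k ∧ v k < e k + 7 / 500) ↔ (∀ k, e k < v k ∧ v k < e k + 7 / 500) := by
    refine forall_congr' fun k => ?_
    constructor
    · rintro ⟨h1, h2⟩
      exact ⟨lt_of_le_of_ne h1 (fun h' => hv k h'.symm), h2⟩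
    · rintro ⟨h1, h2⟩
      exact ⟨h1.le, h2⟩
  by_cases hc : ∀ k, e k ≤ v k ∧ v k < e k + 7 / 500
  · rw [if_pos hc, if_pos (hiff.mp hc)]
  · rw [if_neg hc, if_neg (fun h' => hc (hiff.mpr h'))]

end Summit.Parity.GeneralizedHardyLittlewood.FordMaynardNoSieveConst0164NegWitness0164

end
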